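import Literature.AlgebraicGeometry.Deformation.FlatDeformationGluedIsoCharts
import Literature.AlgebraicGeometry.Deformation.SmoothAffineDeformationsCocycle
import HarnessLib

/-!
# An actual flat deformation is the glued scheme of its transition data, II: `Ψ : Glue_A(ψ) ⟶ Y` is an isomorphism over `Spec A`
# (Hartshorne, *Deformation Theory*, proof of Thm. 10.2 (a), read backwards: «`U'_i ≅ U_i ×_k Spec A'` … glue … to obtain `X'`»)

Layer `Literature/AlgebraicGeometry/Deformation` (THEOREMS only); second (c2c) file of the F3c DICTIONARY (cell
`hodgecm-mathlib`, F-11 (A3); B-p21 lineage).  Imports the first file `FlatDeformationGluedIsoCharts` (the comparison morphism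
`Ψ` with its chart squares) and ★ `SmoothAffineDeformationsCocycle` (`transition`, for the corollary in c2b's currency).
Setting and binders exactly as in the first file; in addition the kernel of `π` is NILPOTENT (`hπ`, e.g. `A` Artinian local)
and the `U' j` COVER `Y` (`hU'cov`).  No flatness / smoothness hypothesis is used: those enter only through the existence of
the data (★ c2b `FlatDeformationTransitionData.exists_transition_data`).

* §3 `trivialisationChart_base` — the chart `Spec (A ⊗_k Γ(U j)) ≅ U' j ↪ Y` of `Ψ` and `Spec (A ⊗_k Γ(U j)) → U j ↪ X ↪ Y` agree
  on points (`Spec (e j)⁻¹` and `Spec (c ↦ 1 ⊗ i♯ c)` are congruent modulo the nilpotent `𝔪·(A ⊗ Γ)`, by `he`);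
  `preimage_gluedToDeformation_eq_opensRange` (`Ψ⁻¹(U' j)` is the `j`-th chart); `isPullback_ι_gluedToDeformation` (the chart
  squares are cartesian, Mathlib `IsOpenImmersion.isPullback`); **`isIso_gluedToDeformation`** (isomorphisms are Zariski-local
  at the target).
* §4 **`exists_glued_iso`** — `∃ Ψ : X'_A(ψ) ⟶ Y, (∀ j, ι j ≫ Ψ = Spec (e j)⁻¹ ≫ (U' j ↪ Y)) ∧ IsIso Ψ ∧ Ψ ≫ Y.hom = q`, and
  **`exists_glued_iso_of_transition`** — the same for `ψ j l := transition (ε₁ j l) (ε₂ j l)` (c2b's output, `hψε` discharged).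

HC_CM is proved only modulo the 7 printed citations until rung 0 closes — nothing here bears on a summit statement.

## References
* [Hartshorne2010] R. Hartshorne, *Deformation Theory*, GTM 257, Springer (2010): Thm. 10.2 (a) and its proof (p. 81);
  Cor. 4.8 (p. 30); Thm. 5.3 (proof) (p. 42).
* [StacksProject] The Stacks Project, Tag 01JA (glueing schemes), Tag 01LH (relative glueing).
* [Hartshorne1977] R. Hartshorne, *Algebraic Geometry*, GTM 52 (1977): II Prop. 2.3 (morphisms into an affine scheme).
-/

noncomputable section

-- `TopCat.Presheaf`/`TopCat.Sheaf` are not reducible (as in Mathlib's `AlgebraicGeometry/Modules`).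
set_option backward.isDefEq.respectTransparency false

open CategoryTheory AlgebraicGeometry Opposite TopologicalSpace Limits
open scoped TensorProduct

universe u

namespace Literature.AlgebraicGeometry.Deformation

open Literature.AlgebraicGeometry.Motives Literature.AlgebraicGeometry.Morphisms SmoothAffineDeformation

section GluedIso

variable {k : Type u} [Field k] {A : Type u} [CommRing A] [Algebra k A] (π : A →ₐ[k] k)
  {X : Over (Spec (CommRingCat.of k))} [instΓ : ∀ W : X.left.Opens, Algebra k Γ(X.left, W)]
  (halg : ∀ (W : X.left.Opens) (s : k), algebraMap k Γ(X.left, W) s = (constToPresheaf X).app (op W) s)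
  {Y : Over (Spec (CommRingCat.of A))} [instΓA : ∀ W : Y.left.Opens, Algebra A Γ(Y.left, W)]
  (halgA : ∀ (W : Y.left.Opens) (a : A), algebraMap A Γ(Y.left, W) a = (constToPresheaf Y).app (op W) a)
  (i : X.left ⟶ Y.left)
  {ι : Type u} (U' : ι → Y.left.affineOpens)
  (b' : (j l : ι) → Γ(Y.left, (U' j).1)) (hb' : ∀ j l, (U' j).1 ⊓ (U' l).1 = Y.left.basicOpen (b' j l))
  (U : ι → X.left.affineOpens) (hU : ∀ j, (U j).1 = i ⁻¹ᵁ (U' j).1)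
  (b : (j l : ι) → Γ(X.left, (U j).1)) (hb : ∀ j l, (U j).1 ⊓ (U l).1 = X.left.basicOpen (b j l))
  (e : ∀ j, A ⊗[k] Γ(X.left, (U j).1) ≃ₐ[A] Γ(Y.left, (U' j).1))
  (he : ∀ j x, i.appLE (U' j).1 (U j).1 (hU j).le (e j x) = specialFibreHom π _ x)
  (ε₁ ε₂ : ∀ j l, A ⊗[k] Γ(X.left, (U j).1 ⊓ (U l).1) ≃ₐ[A] Γ(Y.left, (U' j).1 ⊓ (U' l).1))
  (hε₁ : ∀ j l (a : A) (s : Γ(X.left, (U j).1)),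
    ε₁ j l (a ⊗ₜ X.left.presheaf.map (homOfLE inf_le_left).op s) =
      Y.left.presheaf.map (homOfLE inf_le_left).op (e j (a ⊗ₜ s)))
  (hε₂ : ∀ j l (a : A) (s : Γ(X.left, (U l).1)),
    ε₂ j l (a ⊗ₜ X.left.presheaf.map (homOfLE inf_le_right).op s) =
      Y.left.presheaf.map (homOfLE inf_le_right).op (e l (a ⊗ₜ s)))
  (ψ : (j l : ι) → A ⊗[k] Γ(X.left, (U j).1 ⊓ (U l).1) ≃ₐ[A] A ⊗[k] Γ(X.left, (U j).1 ⊓ (U l).1))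
  (hψε : ∀ j l x, ε₂ j l (ψ j l x) = ε₁ j l x)
  (𝔫 : Ideal A) (h𝔫 : IsNilpotent 𝔫)
  (hψ : ∀ j l x, ψ j l x - x ∈ 𝔫 • (⊤ : Submodule A (A ⊗[k] Γ(X.left, (U j).1 ⊓ (U l).1))))
  (hcoc : ∀ (j l m : ι)
    (Φjl : A ⊗[k] Γ(X.left, (U j).1 ⊓ (U l).1) →ₐ[A] A ⊗[k] Γ(X.left, (U j).1 ⊓ (U l).1 ⊓ (U m).1))
    (_ : ∀ a s, Φjl (a ⊗ₜ s) = a ⊗ₜ X.left.presheaf.map (homOfLE inf_le_left).op s)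
    (Φlm : A ⊗[k] Γ(X.left, (U l).1 ⊓ (U m).1) →ₐ[A] A ⊗[k] Γ(X.left, (U j).1 ⊓ (U l).1 ⊓ (U m).1))
    (_ : ∀ a s, Φlm (a ⊗ₜ s) = a ⊗ₜ X.left.presheaf.map
      (homOfLE (le_inf (inf_le_left.trans inf_le_right) inf_le_right)).op s)
    (Φjm : A ⊗[k] Γ(X.left, (U j).1 ⊓ (U m).1) →ₐ[A] A ⊗[k] Γ(X.left, (U j).1 ⊓ (U l).1 ⊓ (U m).1))
    (_ : ∀ a s, Φjm (a ⊗ₜ s) = a ⊗ₜ X.left.presheaf.map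
      (homOfLE (le_inf (inf_le_left.trans inf_le_left) inf_le_right)).op s)
    (ρjl ρlm ρjm : A ⊗[k] Γ(X.left, (U j).1 ⊓ (U l).1 ⊓ (U m).1) ≃ₐ[A]
      A ⊗[k] Γ(X.left, (U j).1 ⊓ (U l).1 ⊓ (U m).1)),
    (∀ x, ρjl (Φjl x) = Φjl (ψ j l x)) → (∀ x, ρlm (Φlm x) = Φlm (ψ l m x)) →
    (∀ x, ρjm (Φjm x) = Φjm (ψ j m x)) → ρlm * ρjl = ρjm)

/-! ## §3 Points: `Ψ⁻¹(U' j)` is the `j`-th chart; `Ψ` is an isomorphism -/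

include hU he in
/-- **The trivialisation chart has the same underlying map as `Spec (A ⊗_k Γ(U j)) → U j ↪ X ↪ Y`**: `Spec (e j)⁻¹` and
`Spec (c ↦ 1 ⊗ i♯c)` agree on primes, since `(e j)⁻¹ c − 1 ⊗ i♯ c ∈ 𝔪·(A ⊗ Γ)` is nilpotent (`e j` lies over the closed
fibres, `𝔪 = ker π` nilpotent). [cite: Hartshorne2010, Thm. 10.2 (proof), p. 81] -/
theorem trivialisationChart_base (hπ : IsNilpotent (RingHom.ker π)) (j : ι) :
    (Spec.map (CommRingCat.ofHom (e j).symm.toAlgHom.toRingHom) ≫ (U' j).2.fromSpec).base =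
      (chartProj A U j ≫ i).base := by
  have hfac : chartProj A U j ≫ i = Spec.map (CommRingCat.ofHom
      ((Algebra.TensorProduct.includeRight (R := k) (A := A) (B := Γ(X.left, (U j).1))).toRingHom.comp
        (i.appLE (U' j).1 (U j).1 (hU j).le).hom)) ≫ (U' j).2.fromSpec := by
    rw [chartProj_eq, Category.assoc, ← IsAffineOpen.SpecMap_appLE_fromSpec i (U' j).2 (U j).2 (hU j).le,
      ← Spec.map_comp_assoc, CommRingCat.ofHom_comp, CommRingCat.ofHom_hom]
  rw [hfac, Scheme.Hom.comp_base, Scheme.Hom.comp_base]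
  congr 1
  refine SpecMap_base_eq_of_sub_isNilpotent _ _ fun c => ?_
  have hmem : (e j).symm c - (1 : A) ⊗ₜ i.appLE (U' j).1 (U j).1 (hU j).le c ∈
      (RingHom.ker π) • (⊤ : Submodule A (A ⊗[k] Γ(X.left, (U j).1))) := by
    apply ker_specialFibreHom_le π
    rw [map_sub, ← he j, AlgEquiv.apply_symm_apply, specialFibreHom_tmul, map_one, one_smul, sub_self]
  exact isNilpotent_of_mem_smul_top (RingHom.ker π) hπ hmem

include hU in
omit instΓA in
/-- The chart projection followed by the closed fibre lands in `U' j`. [cite: Hartshorne2010, Thm. 10.2 (proof), p. 81] -/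
theorem chartProj_apply_mem_upstairs (j : ι) (y : Spec (CommRingCat.of (A ⊗[k] Γ(X.left, (U j).1)))) :
    i (chartProj A U j y) ∈ (U' j).1 := by
  have h : (U j).2.fromSpec (Spec.map (CommRingCat.ofHom
      (Algebra.TensorProduct.includeRight (R := k) (A := A) (B := Γ(X.left, (U j).1))).toRingHom) y) ∈
      Set.range (U j).2.fromSpec := ⟨_, rfl⟩
  rw [IsAffineOpen.range_fromSpec] at h
  have h' : chartProj A U j y ∈ i ⁻¹ᵁ (U' j).1 := by
    rw [← hU j, chartProj_eq, Scheme.Hom.comp_apply]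
    exact h
  exact h'

include hU he in
/-- **`Ψ⁻¹(U' j)` is exactly the `j`-th chart**: a point `ι l y` with `Ψ (ι l y) ∈ U' j` has `i (p_l y) ∈ U' j`, i.e.
`y ∈ W l j`, so `ι l y = ι j (t l j y)`. [cite: StacksProject, Tag 01JA; Tag 01LH] [cite: Hartshorne2010, Thm. 10.2 (proof), p. 81] -/
theorem preimage_gluedToDeformation_eq_opensRange (hπ : IsNilpotent (RingHom.ker π))
    (Ψ : (deformationGlueDatum halg A U b hb ψ 𝔫 h𝔫 hψ hcoc).glueData.glued ⟶ Y.left)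
    (hΨ : ∀ j, (deformationGlueDatum halg A U b hb ψ 𝔫 h𝔫 hψ hcoc).glueData.ι j ≫ Ψ =
      Spec.map (CommRingCat.ofHom (e j).symm.toAlgHom.toRingHom) ≫ (U' j).2.fromSpec) (j : ι) :
    Ψ ⁻¹ᵁ (U' j).1 = ((deformationGlueDatum halg A U b hb ψ 𝔫 h𝔫 hψ hcoc).glueData.ι j).opensRange := by
  apply TopologicalSpace.Opens.ext
  simp only [TopologicalSpace.Opens.map_coe, Scheme.Hom.coe_opensRange]
  ext x
  constructor
  · intro hx
    obtain ⟨l, y, rfl⟩ := (deformationGlueDatum halg A U b hb ψ 𝔫 h𝔫 hψ hcoc).glueData.ι_jointly_surjective x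
    have hx' : Ψ (((deformationGlueDatum halg A U b hb ψ 𝔫 h𝔫 hψ hcoc).glueData.ι l) y) ∈
        ((U' j).1 : Set Y.left) := hx
    rw [← Scheme.Hom.comp_apply, hΨ l] at hx'
    have hb0 := trivialisationChart_base π i U' U hU e he hπ l
    have hxy : (Spec.map (CommRingCat.ofHom (e l).symm.toAlgHom.toRingHom) ≫ (U' l).2.fromSpec) y =
        i (chartProj A U l y) := by
      change (Spec.map (CommRingCat.ofHom (e l).symm.toAlgHom.toRingHom) ≫ (U' l).2.fromSpec).base y =
        (chartProj A U l ≫ i).base y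
      rw [hb0]
    have hx'' : i (chartProj A U l y) ∈ ((U' j).1 : Set Y.left) := by
      rw [← hxy]
      exact hx'
    have hy : chartProj A U l y ∈ (U l).1 ⊓ (U j).1 := by
      refine ⟨?_, ?_⟩
      · have h2 : chartProj A U l y ∈ i ⁻¹ᵁ (U' l).1 := chartProj_apply_mem_upstairs i U' U hU l y
        rwa [← hU l] at h2
      · have h2 : chartProj A U l y ∈ i ⁻¹ᵁ (U' j).1 := hx''
        rwa [← hU j] at h2
    refine ⟨(deformationGlueDatum halg A U b hb ψ 𝔫 h𝔫 hψ hcoc).t l j ⟨y, hy⟩, ?_⟩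
    change ((deformationGlueDatum halg A U b hb ψ 𝔫 h𝔫 hψ hcoc).t l j ≫
      (deformationGlueDatum halg A U b hb ψ 𝔫 h𝔫 hψ hcoc).glueData.ι j) ⟨y, hy⟩ =
      (((deformationGlueDatum halg A U b hb ψ 𝔫 h𝔫 hψ hcoc).W l j).ι ≫
        (deformationGlueDatum halg A U b hb ψ 𝔫 h𝔫 hψ hcoc).glueData.ι l) ⟨y, hy⟩
    rw [OpensGlueDatum.t_ι]
  · rintro ⟨y, rfl⟩
    change Ψ (((deformationGlueDatum halg A U b hb ψ 𝔫 h𝔫 hψ hcoc).glueData.ι j) y) ∈ ((U' j).1 : Set Y.left)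
    rw [← Scheme.Hom.comp_apply, hΨ j]
    have h : (Spec.map (CommRingCat.ofHom (e j).symm.toAlgHom.toRingHom) ≫ (U' j).2.fromSpec) y ∈
        Set.range (U' j).2.fromSpec := ⟨_, (Scheme.Hom.comp_apply _ _ _).symm⟩
    rw [IsAffineOpen.range_fromSpec] at h
    exact h

/-- `Spec` of the chart trivialisation is an isomorphism `Spec (A ⊗_k Γ(U j)) ≅ Spec Γ(Y, U' j)`.
[cite: Hartshorne2010, Cor. 4.8, p. 30] -/
theorem isIso_SpecMap_symm (j : ι) :
    IsIso (Spec.map (CommRingCat.ofHom (e j).symm.toAlgHom.toRingHom)) := by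
  have h : CommRingCat.ofHom (e j).symm.toAlgHom.toRingHom = (e j).symm.toRingEquiv.toCommRingCatIso.hom :=
    CommRingCat.hom_ext (RingHom.ext fun c => rfl)
  rw [h]
  infer_instance

include hU he in
/-- **The chart squares of `Ψ` are CARTESIAN**: `Spec (A ⊗_k Γ(U j)) = Ψ⁻¹(U' j)` (Mathlib `IsOpenImmersion.isPullback`).
[cite: StacksProject, Tag 01LH] [cite: Hartshorne2010, Thm. 10.2 (proof), p. 81] -/
theorem isPullback_ι_gluedToDeformation (hπ : IsNilpotent (RingHom.ker π))
    (Ψ : (deformationGlueDatum halg A U b hb ψ 𝔫 h𝔫 hψ hcoc).glueData.glued ⟶ Y.left)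
    (hΨ : ∀ j, (deformationGlueDatum halg A U b hb ψ 𝔫 h𝔫 hψ hcoc).glueData.ι j ≫ Ψ =
      Spec.map (CommRingCat.ofHom (e j).symm.toAlgHom.toRingHom) ≫ (U' j).2.fromSpec) (j : ι) :
    IsPullback ((deformationGlueDatum halg A U b hb ψ 𝔫 h𝔫 hψ hcoc).glueData.ι j)
      (Spec.map (CommRingCat.ofHom (e j).symm.toAlgHom.toRingHom) ≫ (U' j).2.isoSpec.inv) Ψ (U' j).1.ι :=
  (IsOpenImmersion.isPullback _ _ _ Ψ (by rw [hΨ j, Category.assoc, IsAffineOpen.isoSpec_inv_ι])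
    (by rw [Scheme.Opens.opensRange_ι]
        exact preimage_gluedToDeformation_eq_opensRange π halg i U' U hU b hb e he ψ 𝔫 h𝔫 hψ hcoc hπ Ψ hΨ j)).flip

include hU he in
/-- **`Ψ : X'_A(ψ) ⟶ Y` IS AN ISOMORPHISM** when the `U' j` cover `Y` (isomorphisms are Zariski-local at the target; over
`U' j` it is the chart isomorphism `Spec (A ⊗_k Γ(U j)) ≅ Spec Γ(Y, U' j) ≅ U' j` by the cartesian chart square).
[cite: Hartshorne2010, Thm. 10.2 (proof), p. 81] [cite: StacksProject, Tag 01JA; Tag 01LH] -/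
theorem isIso_gluedToDeformation (hπ : IsNilpotent (RingHom.ker π)) (hU'cov : IsOpenCover fun j => (U' j).1)
    (Ψ : (deformationGlueDatum halg A U b hb ψ 𝔫 h𝔫 hψ hcoc).glueData.glued ⟶ Y.left)
    (hΨ : ∀ j, (deformationGlueDatum halg A U b hb ψ 𝔫 h𝔫 hψ hcoc).glueData.ι j ≫ Ψ =
      Spec.map (CommRingCat.ofHom (e j).symm.toAlgHom.toRingHom) ≫ (U' j).2.fromSpec) : IsIso Ψ := by
  have h : (MorphismProperty.isomorphisms Scheme.{u}) Ψ := by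
    refine IsZariskiLocalAtTarget.of_openCover (P := MorphismProperty.isomorphisms Scheme.{u})
      (Y.left.openCoverOfIsOpenCover (fun j => (U' j).1) hU'cov) fun j => ?_
    have hc := isPullback_ι_gluedToDeformation π halg i U' U hU b hb e he ψ 𝔫 h𝔫 hψ hcoc hπ Ψ hΨ j
    haveI := isIso_SpecMap_symm U' U e j
    change IsIso (pullback.snd Ψ (U' j).1.ι)
    rw [← hc.isoPullback_inv_snd]
    infer_instance
  exact h

/-! ## §4 The head: `Glue_A(ψ) ≅ Y` over `Spec A` -/

include hb' hε₁ hε₂ hψε hU he halgA in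
/-- **AN ACTUAL FLAT DEFORMATION IS THE GLUED SCHEME OF ITS TRANSITION DATA** (F3c dictionary, (c2c)): for `Y → Spec A`
with closed fibre `i : X → Y`, a covering principal affine cover `U'` of `Y` with downstairs cover `U = i⁻¹U'`, chart
trivialisations `e j : A ⊗_k Γ(U j) ≃ₐ[A] Γ(Y, U' j)` over the closed fibres, overlap restrictions `ε₁, ε₂` and transition
automorphisms `ψ` with `ε₂ ∘ ψ = ε₁` (admissible, cocycle-exact), there is `Ψ : X'_A(ψ) ⟶ Y` with the chart squares
`ι j ≫ Ψ = Spec (e j)⁻¹ ≫ (U' j ↪ Y)`, which is an ISOMORPHISM and lies over `Spec A` (`Ψ ≫ Y.hom = q`).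
[cite: Hartshorne2010, Thm. 10.2 (a) and its proof, p. 81] [cite: StacksProject, Tag 01JA; Tag 01LH] -/
theorem exists_glued_iso (hπ : IsNilpotent (RingHom.ker π)) (hU'cov : IsOpenCover fun j => (U' j).1)
    (q : (deformationGlueDatum halg A U b hb ψ 𝔫 h𝔫 hψ hcoc).glueData.glued ⟶ Spec (CommRingCat.of A))
    (hq : ∀ j, (deformationGlueDatum halg A U b hb ψ 𝔫 h𝔫 hψ hcoc).glueData.ι j ≫ q =
      Spec.map (CommRingCat.ofHom (Algebra.TensorProduct.includeLeftRingHom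
        (R := k) (A := A) (B := Γ(X.left, (U j).1))))) :
    ∃ Ψ : (deformationGlueDatum halg A U b hb ψ 𝔫 h𝔫 hψ hcoc).glueData.glued ⟶ Y.left,
      (∀ j, (deformationGlueDatum halg A U b hb ψ 𝔫 h𝔫 hψ hcoc).glueData.ι j ≫ Ψ =
        Spec.map (CommRingCat.ofHom (e j).symm.toAlgHom.toRingHom) ≫ (U' j).2.fromSpec) ∧
      IsIso Ψ ∧ Ψ ≫ Y.hom = q := by
  obtain ⟨Ψ, hΨ, -⟩ := existsUnique_gluedToDeformation halg U' b' hb' U b hb e ε₁ ε₂ hε₁ hε₂ ψ hψε 𝔫 h𝔫 hψ hcoc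
  exact ⟨Ψ, hΨ, isIso_gluedToDeformation π halg i U' U hU b hb e he ψ 𝔫 h𝔫 hψ hcoc hπ hU'cov Ψ hΨ,
    gluedToDeformation_comp_hom halg halgA U' U b hb e ψ 𝔫 h𝔫 hψ hcoc Ψ hΨ q hq⟩

include hb' hε₁ hε₂ hU he halgA in
/-- **The same, for the transition data of c2b** (`ψ j l := transition (ε₁ j l) (ε₂ j l) = ε₂⁻¹ ∘ ε₁`, ★
`FlatDeformationTransitionData.exists_transition_data`): `Glue_A(transition ε₁ ε₂) ≅ Y` over `Spec A` with the chart
squares `ι j ≫ Ψ = Spec (e j)⁻¹ ≫ (U' j ↪ Y)`. [cite: Hartshorne2010, Thm. 10.2 (a) and its proof, p. 81; Thm. 5.3 (proof), p. 42] -/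
theorem exists_glued_iso_of_transition (hπ : IsNilpotent (RingHom.ker π)) (hU'cov : IsOpenCover fun j => (U' j).1)
    (hψ' : ∀ j l x, transition (ε₁ j l) (ε₂ j l) x - x ∈
      𝔫 • (⊤ : Submodule A (A ⊗[k] Γ(X.left, (U j).1 ⊓ (U l).1))))
    (hcoc' : ∀ (j l m : ι)
      (Φjl : A ⊗[k] Γ(X.left, (U j).1 ⊓ (U l).1) →ₐ[A] A ⊗[k] Γ(X.left, (U j).1 ⊓ (U l).1 ⊓ (U m).1))
      (_ : ∀ a s, Φjl (a ⊗ₜ s) = a ⊗ₜ X.left.presheaf.map (homOfLE inf_le_left).op s)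
      (Φlm : A ⊗[k] Γ(X.left, (U l).1 ⊓ (U m).1) →ₐ[A] A ⊗[k] Γ(X.left, (U j).1 ⊓ (U l).1 ⊓ (U m).1))
      (_ : ∀ a s, Φlm (a ⊗ₜ s) = a ⊗ₜ X.left.presheaf.map
        (homOfLE (le_inf (inf_le_left.trans inf_le_right) inf_le_right)).op s)
      (Φjm : A ⊗[k] Γ(X.left, (U j).1 ⊓ (U m).1) →ₐ[A] A ⊗[k] Γ(X.left, (U j).1 ⊓ (U l).1 ⊓ (U m).1))
      (_ : ∀ a s, Φjm (a ⊗ₜ s) = a ⊗ₜ X.left.presheaf.map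
        (homOfLE (le_inf (inf_le_left.trans inf_le_left) inf_le_right)).op s)
      (ρjl ρlm ρjm : A ⊗[k] Γ(X.left, (U j).1 ⊓ (U l).1 ⊓ (U m).1) ≃ₐ[A]
        A ⊗[k] Γ(X.left, (U j).1 ⊓ (U l).1 ⊓ (U m).1)),
      (∀ x, ρjl (Φjl x) = Φjl (transition (ε₁ j l) (ε₂ j l) x)) →
      (∀ x, ρlm (Φlm x) = Φlm (transition (ε₁ l m) (ε₂ l m) x)) →
      (∀ x, ρjm (Φjm x) = Φjm (transition (ε₁ j m) (ε₂ j m) x)) → ρlm * ρjl = ρjm)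
    (q : (deformationGlueDatum halg A U b hb (fun j l => transition (ε₁ j l) (ε₂ j l)) 𝔫 h𝔫 hψ' hcoc').glueData.glued ⟶
      Spec (CommRingCat.of A))
    (hq : ∀ j, (deformationGlueDatum halg A U b hb (fun j l => transition (ε₁ j l) (ε₂ j l)) 𝔫 h𝔫 hψ' hcoc').glueData.ι j ≫
      q = Spec.map (CommRingCat.ofHom (Algebra.TensorProduct.includeLeftRingHom
        (R := k) (A := A) (B := Γ(X.left, (U j).1))))) :
    ∃ Ψ : (deformationGlueDatum halg A U b hb (fun j l => transition (ε₁ j l) (ε₂ j l)) 𝔫 h𝔫 hψ' hcoc').glueData.glued ⟶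
        Y.left,
      (∀ j, (deformationGlueDatum halg A U b hb (fun j l => transition (ε₁ j l) (ε₂ j l)) 𝔫 h𝔫 hψ' hcoc').glueData.ι j ≫
        Ψ = Spec.map (CommRingCat.ofHom (e j).symm.toAlgHom.toRingHom) ≫ (U' j).2.fromSpec) ∧
      IsIso Ψ ∧ Ψ ≫ Y.hom = q :=
  exists_glued_iso π halg halgA i U' b' hb' U hU b hb e he ε₁ ε₂ hε₁ hε₂ (fun j l => transition (ε₁ j l) (ε₂ j l))
    (fun j l x => by rw [transition_apply, AlgEquiv.apply_symm_apply]) 𝔫 h𝔫 hψ' hcoc' hπ hU'cov q hq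

end GluedIso

end Literature.AlgebraicGeometry.Deformation

end
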